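import Mathlib
import HarnessLib
import Literature.Analysis.Fourier.TorusFourierTailSmooth
import Literature.Analysis.Fourier.TorusGridRiemannSum
import Literature.Algebra.EuclideanLattices.LatticeDescentFourier

/-!
# Descent calculus on the flat torus: products, plane waves, and the partial derivatives of a descended function
# (the hypotheses of the aliasing-tail bound, discharged from derivative bounds on `ℝ^d`)

Topic `Literature/Analysis/Fourier`; namespace `Literature.Analysis.Fourier`.  Companion of `TorusGridRiemannSum` (Riemann sums of a
`ℤ^d`-periodic `g` on `ℝ^d` via `Torus.descend`), `TorusGridAliasingTail` (the aliased tail of `P·g`, `P` a trigonometric polynomial) and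
`TorusFourierTailSmooth` (the tail from `‖∂ⱼ^M g‖ ≤ D`):

* `descend_mul` — `descend (φ·ψ) = descend φ · descend ψ`; `descend_planeWave` — the plane wave `y ↦ exp(2πi Σᵢ xᵢ yᵢ)`, `x ∈ ℤ^d`, descends to the
  character `mFourier x`; hence `descend_trigPoly_mul` — `(Σ_{x∈B} c_x e^{2πi⟨x,·⟩})·ψ` descends to `(Σ_{x∈B} c_x·mFourier x)·descend ψ`, the shape
  `TorusGridAliasingTail.tsum_aliased_norm_mFourierCoeff_trigPoly_mul_le` consumes [cite: Boyd2001, §4.5 Theorem 19 (4.44)];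
* `lift_partialDeriv_iterate_descend` — `lift ((∂ⱼ)^m (descend g)) = (∂_{eⱼ})^m g` (the flat case of
  `LatticePeriodic.lift_partialDeriv_iterate_descend`), `norm_partialDeriv_iterate_descend_le` — `‖(∂ⱼ)^m (descend g)‖ ≤ sup‖D^m g‖` [cite: Grafakos2014, §3.1.1];
* **`tsum_tail_norm_mFourierCoeff_descend_le`** — the aliasing tail of a smooth periodic `g` on `ℝ^d` from `‖D^M g‖ ≤ D`:
  `Σ_{k : ∃ i, N ≤ 2|kᵢ|} ‖𝓕(descend g)(k)‖ ≤ D·(2π)^{-M}·(2/N)^{M−2d}·2^d·C_d` [cite: Grafakos2014, §3.3.3];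
* `norm_iteratedFDeriv_comp_smul_le` — rescaling `y ↦ Φ(c•y)` costs `|c|^m` per `m` derivatives along a direction (via `LatticePeriodic.dirIter_comp_clm`).

Everything is proved; no definitions.  Used by the Hubbard `KLProgramme` (lane c4a-1, LAYER 2: the Brillouin-zone loop integrand is `(ŝ∘e_K)·V` with `V` a
trigonometric polynomial of the four-leg kernel).
-/

noncomputable section

open Complex Finset MeasureTheory UnitAddTorus
open Literature.Analysis.FunctionSpaces Literature.Analysis.FunctionSpaces.Torus
open Literature.Algebra.EuclideanLattices

namespace Literature.Analysis.Fourier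

variable {d : Type*} [Fintype d] [DecidableEq d]

/-! ## §1 Products and plane waves -/

omit [Fintype d] in
/-- **`descend (φ·ψ) = descend φ · descend ψ`.** [cite: Grafakos2014, §3.1.1] -/
theorem descend_mul (φ ψ : EuclideanSpace ℝ d → ℂ) (hφ : Torus.IsLatticePeriodic φ) (hψ : Torus.IsLatticePeriodic ψ)
    (hφψ : Torus.IsLatticePeriodic fun y => φ y * ψ y) :
    Torus.descend (fun y => φ y * ψ y) hφψ = fun t => Torus.descend φ hφ t * Torus.descend ψ hψ t := by
  funext t
  simp only [Torus.descend_apply]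

omit [Fintype d] in
/-- A product of periodic functions is periodic. [cite: Grafakos2014, §3.1.1] -/
theorem isLatticePeriodic_mul {φ ψ : EuclideanSpace ℝ d → ℂ} (hφ : Torus.IsLatticePeriodic φ) (hψ : Torus.IsLatticePeriodic ψ) :
    Torus.IsLatticePeriodic fun y => φ y * ψ y := fun j y => by
  simp only [hφ j y, hψ j y]

/-- **The plane wave `y ↦ exp(2πi Σᵢ xᵢ yᵢ)` (`x ∈ ℤ^d`) is `ℤ^d`-periodic.** [cite: Grafakos2014, §3.1.1] -/
theorem isLatticePeriodic_planeWave (x : d → ℤ) :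
    Torus.IsLatticePeriodic fun y : EuclideanSpace ℝ d => Complex.exp (2 * Real.pi * Complex.I * (∑ i, (x i : ℝ) * y i : ℝ)) := by
  classical
  intro j y
  have hsum : (∑ i, (x i : ℝ) * (y + EuclideanSpace.single j (1 : ℝ)) i : ℝ) = (∑ i, (x i : ℝ) * y i) + (x j : ℝ) := by
    simp only [PiLp.add_apply, PiLp.single_apply, mul_add, Finset.sum_add_distrib, mul_ite, mul_one, mul_zero,
      Finset.sum_ite_eq', Finset.mem_univ, if_true]
  simp only [hsum]
  push_cast
  rw [mul_add, Complex.exp_add]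
  have h1 : Complex.exp (2 * Real.pi * Complex.I * (x j : ℂ)) = 1 := by
    rw [show 2 * (Real.pi : ℂ) * Complex.I * (x j : ℂ) = (x j : ℂ) * (2 * Real.pi * Complex.I) by ring]
    exact Complex.exp_int_mul_two_pi_mul_I (x j)
  rw [h1, mul_one]

/-- **The plane wave descends to the character**: `descend (y ↦ exp(2πi Σᵢ xᵢ yᵢ)) = mFourier x`. [cite: Grafakos2014, §3.1.1] -/
theorem descend_planeWave (x : d → ℤ) :
    Torus.descend (fun y : EuclideanSpace ℝ d => Complex.exp (2 * Real.pi * Complex.I * (∑ i, (x i : ℝ) * y i : ℝ)))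
        (isLatticePeriodic_planeWave x) = mFourier x := by
  funext t
  rw [Torus.descend_apply]
  conv_rhs => rw [← Torus.proj_repr t]
  simp only [mFourier, ContinuousMap.coe_mk, Torus.proj_apply, fourier_coe_apply]
  rw [← Complex.exp_sum]
  congr 1
  push_cast
  rw [Finset.mul_sum]
  refine Finset.sum_congr rfl fun i _ => ?_
  ring

/-- **A trigonometric polynomial times `ψ` descends to `(Σ_{x∈B} c_x·mFourier x)·descend ψ`** — the shape of the aliased-tail lemma
`tsum_aliased_norm_mFourierCoeff_trigPoly_mul_le`. [cite: Boyd2001, §4.5 Theorem 19 (4.44)] -/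
theorem descend_trigPoly_mul (B : Finset (d → ℤ)) (c : (d → ℤ) → ℂ) (ψ : EuclideanSpace ℝ d → ℂ) (hψ : Torus.IsLatticePeriodic ψ)
    (h : Torus.IsLatticePeriodic fun y : EuclideanSpace ℝ d =>
      (∑ x ∈ B, c x * Complex.exp (2 * Real.pi * Complex.I * (∑ i, (x i : ℝ) * y i : ℝ))) * ψ y) :
    Torus.descend (fun y : EuclideanSpace ℝ d => (∑ x ∈ B, c x * Complex.exp (2 * Real.pi * Complex.I * (∑ i, (x i : ℝ) * y i : ℝ))) * ψ y) h =
      fun t => (∑ x ∈ B, c x * mFourier x t) * Torus.descend ψ hψ t := by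
  funext t
  rw [Torus.descend_apply, Torus.descend_apply]
  congr 1
  refine Finset.sum_congr rfl fun x _ => ?_
  have hx := congrFun (descend_planeWave x) t
  rw [Torus.descend_apply] at hx
  rw [hx]

/-- The trigonometric polynomial times a periodic `ψ` is periodic (the hypothesis `h` of `descend_trigPoly_mul`). [cite: Grafakos2014, §3.1.1] -/
theorem isLatticePeriodic_trigPoly_mul (B : Finset (d → ℤ)) (c : (d → ℤ) → ℂ) {ψ : EuclideanSpace ℝ d → ℂ} (hψ : Torus.IsLatticePeriodic ψ) :
    Torus.IsLatticePeriodic fun y : EuclideanSpace ℝ d =>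
      (∑ x ∈ B, c x * Complex.exp (2 * Real.pi * Complex.I * (∑ i, (x i : ℝ) * y i : ℝ))) * ψ y := by
  intro j y
  have hw : ∀ x ∈ B, c x * Complex.exp (2 * Real.pi * Complex.I * (∑ i, (x i : ℝ) * (y + EuclideanSpace.single j (1 : ℝ)) i : ℝ)) =
      c x * Complex.exp (2 * Real.pi * Complex.I * (∑ i, (x i : ℝ) * y i : ℝ)) := fun x _ => by
    have h := isLatticePeriodic_planeWave x j y
    beta_reduce at h
    rw [h]
  beta_reduce
  rw [Finset.sum_congr rfl hw, hψ j y]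

/-! ## §2 Partial derivatives of a descended function -/

/-- **`lift ((∂ⱼ)^m (descend g)) = (∂_{eⱼ})^m g`** for smooth periodic `g` on `ℝ^d` (iterated directional derivative along `eⱼ = single j 1`).
[cite: Grafakos2014, §3.1.1] -/
theorem lift_partialDeriv_iterate_descend {g : EuclideanSpace ℝ d → ℂ} (hg : ContDiff ℝ (⊤ : ℕ∞) g) (hper : Torus.IsLatticePeriodic g) (j : d) (m : ℕ) :
    Torus.lift ((Torus.partialDeriv j)^[m] (Torus.descend g hper)) = LatticePeriodic.dirIter (EuclideanSpace.single j (1 : ℝ)) m g := by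
  induction m with
  | zero =>
    rw [Function.iterate_zero, id_eq, Torus.lift_descend_holds]
    rfl
  | succ m ih =>
    rw [Function.iterate_succ', Function.comp_apply]
    have hsm : Torus.IsSmooth ((Torus.partialDeriv j)^[m] (Torus.descend g hper)) :=
      Torus.isSmooth_partialDeriv_iterate (isSmooth_descend g hper hg) j m
    rw [show Torus.partialDeriv j ((Torus.partialDeriv j)^[m] (Torus.descend g hper)) =
        fun x => Torus.lineDeriv ((Torus.partialDeriv j)^[m] (Torus.descend g hper)) x (EuclideanSpace.single j 1) from rfl,
      Torus.lift_lineDeriv (Torus.IsSmooth.isContDiff hsm (by exact_mod_cast le_top)), ih, LatticePeriodic.dirIter_succ]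

/-- **`‖(∂ⱼ)^m (descend g)‖ ≤ sup ‖D^m g‖`** for smooth periodic `g` on `ℝ^d`. [cite: Grafakos2014, §3.1.1] -/
theorem norm_partialDeriv_iterate_descend_le {g : EuclideanSpace ℝ d → ℂ} (hg : ContDiff ℝ (⊤ : ℕ∞) g) (hper : Torus.IsLatticePeriodic g)
    (j : d) (m : ℕ) {D : ℝ} (hD : ∀ y, ‖iteratedFDeriv ℝ m g y‖ ≤ D) (t : UnitAddTorus d) :
    ‖((Torus.partialDeriv j)^[m] (Torus.descend g hper)) t‖ ≤ D := by
  obtain ⟨y, rfl⟩ := Torus.proj_surjective t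
  have h := congrFun (lift_partialDeriv_iterate_descend hg hper j m) y
  rw [Torus.lift_apply] at h
  rw [h]
  refine (LatticePeriodic.norm_dirIter_le hg _ m _).trans ?_
  have hn : ‖EuclideanSpace.single j (1 : ℝ)‖ = 1 := by simp
  rw [hn, one_pow, mul_one]
  exact hD y

/-! ## §3 The aliasing tail of a smooth periodic function on `ℝ^d` -/

/-- **THE ALIASING TAIL FROM PLANE DERIVATIVE BOUNDS.**  For a smooth `ℤ^d`-periodic `g` on `ℝ^d` with `‖D^M g‖ ≤ D` (`2d ≤ M`) and `N ≥ 1`: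
`Σ_{k : ∃ i, N ≤ 2|kᵢ|} ‖𝓕(descend g)(k)‖ ≤ D·(2π)^{-M}·(2/N)^{M−2d}·2^d·Σ_{k ∈ ℤ^d} ∏ⱼ(1 + kⱼ²)⁻¹`. [cite: Grafakos2014, §3.3.3] -/
theorem tsum_tail_norm_mFourierCoeff_descend_le [Nonempty d] {g : EuclideanSpace ℝ d → ℂ} (hg : ContDiff ℝ (⊤ : ℕ∞) g)
    (hper : Torus.IsLatticePeriodic g) {M : ℕ} (hM : 2 * Fintype.card d ≤ M) {D : ℝ} (hD : ∀ y, ‖iteratedFDeriv ℝ M g y‖ ≤ D) {N : ℕ}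
    (hN : 1 ≤ N) :
    ∑' k : d → ℤ, (if ∃ i, (N : ℤ) ≤ 2 * |k i| then ‖mFourierCoeff (Torus.descend g hper) k‖ else 0) ≤
      D / (2 * Real.pi) ^ M * (2 / (N : ℝ)) ^ (M - 2 * Fintype.card d) *
        (2 ^ Fintype.card d * ∑' k : d → ℤ, ∏ j, (1 + (k j : ℝ) ^ 2)⁻¹) :=
  tsum_tail_norm_mFourierCoeff_le (isSmooth_descend g hper hg) hM (fun j t => norm_partialDeriv_iterate_descend_le hg hper j M hD t) hN

/-! ## §4 Rescaling -/

/-- **Rescaling costs `|c|^m`**: for smooth `Φ` on a normed space and `g = Φ(c • ·)`, the iterated directional derivative along `v` satisfies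
`‖(∂_v)^m g (y)‖ ≤ ‖D^m Φ(c•y)‖·(|c|‖v‖)^m`. [cite: Grafakos2014, §3.1.1] -/
theorem norm_dirIter_comp_smul_le {V : Type*} [NormedAddCommGroup V] [NormedSpace ℝ V] {Φ : V → ℂ} (hΦ : ContDiff ℝ (⊤ : ℕ∞) Φ) (c : ℝ)
    (v : V) (m : ℕ) (y : V) :
    ‖LatticePeriodic.dirIter v m (fun w => Φ (c • w)) y‖ ≤ ‖iteratedFDeriv ℝ m Φ (c • y)‖ * (|c| * ‖v‖) ^ m := by
  have h := congrFun (LatticePeriodic.dirIter_comp_clm hΦ (c • ContinuousLinearMap.id ℝ V) v m) y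
  simp only [FunLike.coe_smul, Pi.smul_apply, ContinuousLinearMap.coe_id', id_eq] at h
  rw [h]
  refine (LatticePeriodic.norm_dirIter_le hΦ _ m _).trans (le_of_eq ?_)
  rw [norm_smul, Real.norm_eq_abs]

end Literature.Analysis.Fourier

end
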